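import Literature.NumberTheory.LFunctions.MauduitRivatFourier
import Literature.NumberTheory.LFunctions.MoebiusAutomaticCarry
import HarnessLib

/-!
# Mauduit–Rivat's decomposition `f̂ = G₁ + G₂` of the Fourier transform by the carry property ((33)–(37); proved)

Everything in this file is PROVED. It formalises, in C. Müllner's group/representation-valued
setting (Duke Math. J. 166 (2017), Prop. 5.4: "We find
`f̂_{μ+ν}(t) = k^{-(μ+ν−α)} ∑_v f(vk^α) e(−vt/k^{μ+ν−α}) · k^{−α} ∑_u f(vk^α)^H f(u + vk^α) e(−ut/k^{μ+ν})`.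
Here we needed to ensure the correct order of the terms"), the decomposition (33)–(37) in the
proof of Prop. 1 of C. Mauduit, J. Rivat, J. Eur. Math. Soc. 17 (2015), pp. 2606–2607:
writing `ℓ = u + v k^κ` (`u < k^κ`, `v < k^λ`, `K = k^{κ+λ}`) and using the carry property to
replace the quotient `f(vk^κ + u) f(vk^κ)⁻¹` by its truncation `c(u, v mod k^ρ)`
(`localQuot`) outside an exceptional set of `v`, one gets `f̂ = Ĝ₁ + Ĝ₂` with

* `mainPart` / `errPart` — the sequences `n ↦ D(c(u, v mod k^ρ)) F(vk^κ)` and `F − mainPart`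
  (`n = u + vk^κ`), so that `dftR K F = dftR K mainPart + dftR K errPart` (`dftR_mainPart_add`);
* `dftR_mainPart_eq` — **(37)**: `dftR K mainPart t = ∑_{h<k^ρ} P_h(t) · Φ_h(t)` with
  `P_h(t) = k^{−κ} ∑_{u<k^κ} e(−ut/K) C(u,h)`, `C(u,h) = dftR (k^ρ) (w ↦ D c(u,w)) h`
  (`coefC`, `phaseSumP`) and `Φ_h(t) = k^{−λ} ∑_{v<k^λ} e(−v(t/k^λ − h/k^ρ)) F(vk^κ)`
  (`fourierPiece`, exactly the shape of the Fourier property, Müllner Def. 4.2);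
* `norm_dftR_mainPart_le` — `‖dftR K mainPart t‖ ≤ k^{−γ(λ)} ∑_h ‖P_h(t)‖` for `F ∈ F_{γ,c}`,
  `κ ≤ cλ`;
* `errPart_eq_zero` — `errPart` vanishes at `n = u + vk^κ` unless `v` is a carry violation
  (`carryViolations k f λ κ ρ`, Müllner Def. 4.1), and `norm_errPart_le` — `‖errPart n‖ ≤ (1+B)B`.

Conventions: the tree's carry property controls `f x · (f y)⁻¹` (prefix on the right), so the
digit-local factor multiplies on the LEFT: `F(u + vk^κ) = D(c) · F(vk^κ)`; values live in a
normed ring `A` that is a complex inner product space with compatible actions (matrices with the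
Frobenius norm in Müllner's case), `F = D ∘ f` for a homomorphism `D : G →* A`.

## References
* C. Mauduit, J. Rivat, J. Eur. Math. Soc. 17 (2015), proof of Prop. 1, (33)–(37).
  [MauduitRivat2015]
* C. Müllner, Duke Math. J. 166 (2017), Def. 4.1, Def. 4.2, Prop. 5.4 (arXiv:1602.03042,
  pp. 19, 26–27). [Mullner2017]
-/

noncomputable section

open Finset Complex
open scoped FourierTransform

namespace Literature.NumberTheory.LFunctions.MauduitRivat

/-! ## Arithmetic of the digit split `n = u + v k^κ` -/

/-- `∑_{n<k^{κ+λ}} g(n) = ∑_{v<k^λ} ∑_{u<k^κ} g(u + vk^κ)`. [folklore] -/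
theorem sum_range_pow_add_digitSplit {M : Type*} [AddCommMonoid M] (g : ℕ → M) (k κ lam : ℕ) :
    ∑ n ∈ range (k ^ (κ + lam)), g n = ∑ v ∈ range (k ^ lam), ∑ u ∈ range (k ^ κ), g (u + v * k ^ κ) := by
  have key : ∀ b : ℕ, ∑ n ∈ range (k ^ κ * b), g n =
      ∑ v ∈ range b, ∑ u ∈ range (k ^ κ), g (u + v * k ^ κ) := by
    intro b
    induction b with
    | zero => simp
    | succ b ih =>
      rw [Nat.mul_succ, Finset.sum_range_add, ih, Finset.sum_range_succ]
      congr 1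
      exact sum_congr rfl fun u _ => by rw [add_comm, mul_comm]
  rw [pow_add]
  exact key _

/-- `(u + vk^κ) / k^κ = v` for `u < k^κ`. [folklore] -/
theorem add_mul_pow_div {k κ u : ℕ} (hu : u < k ^ κ) (v : ℕ) : (u + v * k ^ κ) / k ^ κ = v := by
  have h0 : 0 < k ^ κ := by omega
  rw [Nat.add_mul_div_right _ _ h0, Nat.div_eq_of_lt hu, zero_add]

/-- `(u + vk^κ) % k^κ = u` for `u < k^κ`. [folklore] -/
theorem add_mul_pow_mod {k κ u : ℕ} (hu : u < k ^ κ) (v : ℕ) : (u + v * k ^ κ) % k ^ κ = u := by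
  rw [Nat.add_mul_mod_self_right, Nat.mod_eq_of_lt hu]

/-- Truncation to `κ + ρ` digits: `(vk^κ + u) mod k^{κ+ρ} = (v mod k^ρ) k^κ + u` (`u < k^κ`).
[folklore] -/
theorem mul_pow_add_mod {k : ℕ} (hk : 0 < k) (κ ρ : ℕ) {u : ℕ} (hu : u < k ^ κ) (v : ℕ) :
    (v * k ^ κ + u) % k ^ (κ + ρ) = (v % k ^ ρ) * k ^ κ + u := by
  have hlt : (v % k ^ ρ) * k ^ κ + u < k ^ (κ + ρ) := by
    have h1 : v % k ^ ρ + 1 ≤ k ^ ρ := Nat.mod_lt _ (by positivity)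
    calc (v % k ^ ρ) * k ^ κ + u < (v % k ^ ρ) * k ^ κ + k ^ κ := by omega
      _ = (v % k ^ ρ + 1) * k ^ κ := by ring
      _ ≤ k ^ ρ * k ^ κ := Nat.mul_le_mul_right _ h1
      _ = k ^ (κ + ρ) := by rw [pow_add, mul_comm]
  have hdecomp : v * k ^ κ + u = k ^ (κ + ρ) * (v / k ^ ρ) + ((v % k ^ ρ) * k ^ κ + u) := by
    conv_lhs => rw [← Nat.div_add_mod v (k ^ ρ)]
    rw [pow_add]; ring
  rw [hdecomp, Nat.mul_add_mod, Nat.mod_eq_of_lt hlt]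

/-! ## The local quotient and the carry replacement -/

section Group

variable {G : Type*} [Group G]

/-- The digit-local quotient `c(u, w) = f(wk^κ + u) · f(wk^κ)⁻¹` (Mauduit–Rivat's
`f_{κ+ρ₁}(u + wq^κ) \overline{f_{κ+ρ₁}(wq^κ)}` in the tree's group convention).
[cite: MauduitRivat2015, (37)] -/
def localQuot (k κ : ℕ) (f : ℕ → G) (u w : ℕ) : G := f (w * k ^ κ + u) * (f (w * k ^ κ))⁻¹

/-- Unfolding. [folklore] -/
theorem localQuot_apply (k κ : ℕ) (f : ℕ → G) (u w : ℕ) :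
    localQuot k κ f u w = f (w * k ^ κ + u) * (f (w * k ^ κ))⁻¹ := rfl

/-- **The carry replacement** (Mauduit–Rivat (34)–(35) / Müllner Def. 4.1 with `n₁ = 0`): if
`v < k^λ` is not a carry violation for `(λ, κ, ρ)` then for every `u < k^κ`,
`f(vk^κ + u) f(vk^κ)⁻¹ = c(u, v mod k^ρ)`. [cite: MauduitRivat2015, (34)–(36)] -/
theorem quot_eq_localQuot_of_not_mem {k : ℕ} (hk : 0 < k) {κ lam ρ : ℕ} {f : ℕ → G} {u v : ℕ}
    (hu : u < k ^ κ) (hvl : v < k ^ lam) (hv : v ∉ carryViolations k f lam κ ρ) :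
    f (v * k ^ κ + u) * (f (v * k ^ κ))⁻¹ = localQuot k κ f u (v % k ^ ρ) := by
  have h : f (v * k ^ κ + 0 + u) * (f (v * k ^ κ + 0))⁻¹ =
      f ((v * k ^ κ + 0 + u) % k ^ (κ + ρ)) * (f ((v * k ^ κ + 0) % k ^ (κ + ρ)))⁻¹ := by
    by_contra hne
    exact hv (mem_carryViolations.2 ⟨hvl, 0, by positivity, u, hu, hne⟩)
  simp only [add_zero] at h
  have h0 := mul_pow_add_mod hk κ ρ (u := 0) (by positivity) v
  simp only [add_zero] at h0
  rw [h, localQuot_apply, mul_pow_add_mod hk κ ρ hu, h0]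

end Group

/-! ## Linearity of the discrete Fourier transform -/

section Linear

variable {E : Type*} [NormedAddCommGroup E] [NormedSpace ℂ E]

/-- `dftR` is additive. [folklore] -/
theorem dftR_add (K : ℕ) (F₁ F₂ : ℕ → E) (t : ℝ) :
    dftR K (fun n => F₁ n + F₂ n) t = dftR K F₁ t + dftR K F₂ t := by
  simp only [dftR_apply, smul_add, sum_add_distrib]

/-- Shifting the frequency by `−rK/m` twists by `e(rn/m)`:
`dftR K F (t − rK/m) = K⁻¹ ∑_{n<K} e(rn/m) • (e(−nt/K) • F n)` (`K ≥ 1`). [folklore] -/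
theorem dftR_sub_eq (K : ℕ) (hK : 0 < K) (F : ℕ → E) (t r m : ℝ) :
    dftR K F (t - r * K / m) =
      ((K : ℂ)⁻¹) • ∑ n ∈ range K, (𝐞 (r / m * n) : ℂ) • ((𝐞 (-((n : ℝ) * t / K)) : ℂ) • F n) := by
  have hK0 : (K : ℝ) ≠ 0 := by exact_mod_cast hK.ne'
  rw [dftR_apply]
  congr 1
  refine sum_congr rfl fun n _ => ?_
  rw [smul_smul, coe_fourierChar_mul]
  congr 2
  field_simp
  ring

/-- Hence `‖dftR K F (t − rK/m)‖ = K⁻¹ ‖∑_{n<K} e((r/m) n) • (e(−nt/K) • F n)‖`. [folklore] -/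
theorem norm_dftR_sub_eq (K : ℕ) (hK : 0 < K) (F : ℕ → E) (t r m : ℝ) :
    ‖dftR K F (t - r * K / m)‖ =
      (K : ℝ)⁻¹ * ‖∑ n ∈ range K, (𝐞 (r / m * n) : ℂ) • ((𝐞 (-((n : ℝ) * t / K)) : ℂ) • F n)‖ := by
  rw [dftR_sub_eq K hK, norm_smul, norm_inv, Complex.norm_natCast]

end Linear

/-! ## The setting: `A`-valued `F = D ∘ f` -/

section Setting

variable {A : Type*} [NormedRing A] [NormedSpace ℂ A]
variable {G : Type*} [Group G]

variable (k κ lam ρ : ℕ) (f : ℕ → G) (D : G →* A) (F : ℕ → A)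

/-- The main part `n = u + vk^κ ↦ D(c(u, v mod k^ρ)) · F(vk^κ)` (the sequence whose transform is
Mauduit–Rivat's `G_{κ,1}`). [cite: MauduitRivat2015, (36)–(37)] -/
def mainPart : ℕ → A := fun n =>
  D (localQuot k κ f (n % k ^ κ) ((n / k ^ κ) % k ^ ρ)) * F (n / k ^ κ * k ^ κ)

/-- The error part `F − mainPart` (whose transform is `G_{κ,2}`), supported on carry violations.
[cite: MauduitRivat2015, (36)] -/
def errPart : ℕ → A := fun n => F n - mainPart k κ ρ f D F n

/-- Mauduit–Rivat's coefficients `c_{κ,ρ₁}(u, h) = k^{−ρ} ∑_{w<k^ρ} D(c(u,w)) e(−hw/k^ρ)`.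
[cite: MauduitRivat2015, (37)] -/
def coefC (u h : ℕ) : A := dftR (k ^ ρ) (fun w => (D (localQuot k κ f u w) : A)) (h : ℝ)

/-- The `u`-sum `P_h(t) = k^{−κ} ∑_{u<k^κ} e(−ut/K) c(u,h)`, `K = k^{κ+λ}`.
[cite: MauduitRivat2015, display after (37)] -/
def phaseSumP (t : ℝ) (h : ℕ) : A :=
  (((k ^ κ : ℕ) : ℂ)⁻¹) • ∑ u ∈ range (k ^ κ),
    (𝐞 (-((u : ℝ) * t / (k ^ (κ + lam) : ℕ))) : ℂ) • coefC k κ ρ f D u h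

/-- The `v`-sum `Φ_h(t) = k^{−λ} ∑_{v<k^λ} e(−v(t/k^λ − h/k^ρ)) F(vk^κ)`, in the exact shape of the
Fourier property (Müllner Def. 4.2 with `α = κ`). [cite: MauduitRivat2015, display after (37)] -/
def fourierPiece (t : ℝ) (h : ℕ) : A :=
  ((k : ℝ) ^ lam)⁻¹ • ∑ v ∈ range (k ^ lam),
    (𝐞 (-((v : ℝ) * (t / (k : ℝ) ^ lam - (h : ℝ) / (k : ℝ) ^ ρ))) : ℂ) • F (v * k ^ κ)

variable {k κ lam ρ f D F}

omit [NormedSpace ℂ A] in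
/-- `F = mainPart + errPart`. [folklore] -/
theorem mainPart_add_errPart (n : ℕ) : mainPart k κ ρ f D F n + errPart k κ ρ f D F n = F n := by
  rw [errPart]; abel

/-- `dftR K F = dftR K mainPart + dftR K errPart`. [cite: MauduitRivat2015, (36)] -/
theorem dftR_mainPart_add (K : ℕ) (t : ℝ) :
    dftR K (mainPart k κ ρ f D F) t + dftR K (errPart k κ ρ f D F) t = dftR K F t := by
  rw [← dftR_add]
  simp only [mainPart_add_errPart]

omit [NormedSpace ℂ A] in
/-- The main part at `n = u + vk^κ`: `D(c(u, v mod k^ρ)) F(vk^κ)`. [folklore] -/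
theorem mainPart_digit {u : ℕ} (hu : u < k ^ κ) (v : ℕ) :
    mainPart k κ ρ f D F (u + v * k ^ κ) = D (localQuot k κ f u (v % k ^ ρ)) * F (v * k ^ κ) := by
  simp only [mainPart, add_mul_pow_div hu, add_mul_pow_mod hu]

omit [NormedSpace ℂ A] in
/-- **The error part is supported on carry violations**: for `F = D ∘ f`, `u < k^κ`, `v < k^λ`
not a carry violation, `errPart (u + vk^κ) = 0`. [cite: MauduitRivat2015, (34)–(36)] -/
theorem errPart_eq_zero (hk : 0 < k) (hF : ∀ n, F n = D (f n)) {u v : ℕ} (hu : u < k ^ κ)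
    (hvl : v < k ^ lam) (hv : v ∉ carryViolations k f lam κ ρ) :
    errPart k κ ρ f D F (u + v * k ^ κ) = 0 := by
  show F (u + v * k ^ κ) - mainPart k κ ρ f D F (u + v * k ^ κ) = 0
  rw [mainPart_digit hu, ← quot_eq_localQuot_of_not_mem hk hu hvl hv, hF, hF, ← map_mul,
    inv_mul_cancel_right, show u + v * k ^ κ = v * k ^ κ + u from add_comm _ _, sub_self]

omit [NormedSpace ℂ A] in
/-- `‖errPart n‖ ≤ (1 + B) B` when `‖D g‖ ≤ B` and `F = D ∘ f`. [folklore] -/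
theorem norm_errPart_le (hF : ∀ n, F n = D (f n)) {B : ℝ} (hB : ∀ g, ‖D g‖ ≤ B) (n : ℕ) :
    ‖errPart k κ ρ f D F n‖ ≤ (1 + B) * B := by
  have hB0 : 0 ≤ B := le_trans (norm_nonneg _) (hB 1)
  show ‖F n - mainPart k κ ρ f D F n‖ ≤ (1 + B) * B
  simp only [mainPart]
  refine (norm_sub_le _ _).trans ?_
  rw [hF, hF, add_mul, one_mul]
  refine add_le_add (hB _) ((norm_mul_le _ _).trans ?_)
  exact mul_le_mul (hB _) (hB _) (norm_nonneg _) hB0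

omit [NormedSpace ℂ A] in
/-- `‖mainPart n‖ ≤ B²`. [folklore] -/
theorem norm_mainPart_le (hF : ∀ n, F n = D (f n)) {B : ℝ} (hB : ∀ g, ‖D g‖ ≤ B) (n : ℕ) :
    ‖mainPart k κ ρ f D F n‖ ≤ B * B := by
  have hB0 : 0 ≤ B := le_trans (norm_nonneg _) (hB 1)
  simp only [mainPart]
  rw [hF]
  exact (norm_mul_le _ _).trans (mul_le_mul (hB _) (hB _) (norm_nonneg _) hB0)

/-! ## The factorization (37) -/

/-- Fourier inversion for the local quotients:
`D(c(u, v mod k^ρ)) = ∑_{h<k^ρ} e(vh/k^ρ) • C(u,h)` (`k ≥ 1`). [cite: MauduitRivat2015, (37)] -/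
theorem localQuot_eq_sum_coefC (hk : 0 < k) (u v : ℕ) :
    (D (localQuot k κ f u (v % k ^ ρ)) : A) =
      ∑ h ∈ range (k ^ ρ), (𝐞 ((v : ℝ) * h / (k ^ ρ : ℕ)) : ℂ) • coefC k κ ρ f D u h := by
  have h := periodize_eq_sum_dftR (K := k ^ ρ) (by positivity) (fun w => (D (localQuot k κ f u w) : A)) v
  rw [periodize_apply] at h
  exact h

/-- The exponent identity behind (37): with `K = k^{κ+λ}`,
`e(−(u+vk^κ)t/K) e(vh/k^ρ) = e(−ut/K) e(−v(t/k^λ − h/k^ρ))`. [folklore] -/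
theorem fourierChar_digitSplit (hk : 0 < k) (t : ℝ) (u v h : ℕ) :
    (𝐞 (-(((u + v * k ^ κ : ℕ) : ℝ) * t / (k ^ (κ + lam) : ℕ))) : ℂ) *
        (𝐞 ((v : ℝ) * h / (k ^ ρ : ℕ)) : ℂ) =
      (𝐞 (-((u : ℝ) * t / (k ^ (κ + lam) : ℕ))) : ℂ) *
        (𝐞 (-((v : ℝ) * (t / (k : ℝ) ^ lam - (h : ℝ) / (k : ℝ) ^ ρ))) : ℂ) := by
  have hk0 : (k : ℝ) ≠ 0 := by exact_mod_cast hk.ne'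
  rw [coe_fourierChar_mul, coe_fourierChar_mul]
  congr 2
  push_cast
  field_simp
  ring

variable [IsScalarTower ℂ A A] [SMulCommClass ℂ A A]

/-- `(a • X)(b • Y) = (ab) • (XY)` in `A`. [folklore] -/
theorem smul_mul_smul' (a b : ℂ) (X Y : A) : (a • X) * (b • Y) = (a * b) • (X * Y) :=
  smul_mul_smul_comm a X b Y

/-- **Mauduit–Rivat (37), vector-valued**: for `k ≥ 1`,
`dftR (k^{κ+λ}) mainPart t = ∑_{h<k^ρ} P_h(t) · Φ_h(t)`. [cite: MauduitRivat2015, (37)] -/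
theorem dftR_mainPart_eq (hk : 0 < k) (t : ℝ) :
    dftR (k ^ (κ + lam)) (mainPart k κ ρ f D F) t =
      ∑ h ∈ range (k ^ ρ), phaseSumP k κ lam ρ f D t h * fourierPiece k κ lam ρ F t h := by
  have hk0 : (k : ℂ) ≠ 0 := by exact_mod_cast hk.ne'
  -- Left-hand side as a triple sum `∑_v ∑_u ∑_h`.
  have hL : dftR (k ^ (κ + lam)) (mainPart k κ ρ f D F) t =
      (((k ^ (κ + lam) : ℕ) : ℂ)⁻¹) • ∑ v ∈ range (k ^ lam), ∑ u ∈ range (k ^ κ), ∑ h ∈ range (k ^ ρ),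
        ((𝐞 (-(((u + v * k ^ κ : ℕ) : ℝ) * t / (k ^ (κ + lam) : ℕ))) : ℂ) *
          (𝐞 ((v : ℝ) * h / (k ^ ρ : ℕ)) : ℂ)) •
          (coefC k κ ρ f D u h * F (v * k ^ κ)) := by
    rw [dftR_apply, sum_range_pow_add_digitSplit]
    congr 1
    refine sum_congr rfl fun v _ => sum_congr rfl fun u hu => ?_
    rw [mainPart_digit (mem_range.1 hu), localQuot_eq_sum_coefC hk, sum_mul, smul_sum]
    refine sum_congr rfl fun h _ => ?_
    rw [smul_mul_assoc, smul_smul]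
  -- Right-hand side as a triple sum `∑_h ∑_u ∑_v`.
  have hR : ∑ h ∈ range (k ^ ρ), phaseSumP k κ lam ρ f D t h * fourierPiece k κ lam ρ F t h =
      ∑ h ∈ range (k ^ ρ), ∑ u ∈ range (k ^ κ), ∑ v ∈ range (k ^ lam),
        ((((k ^ κ : ℕ) : ℂ)⁻¹ * (((k : ℝ) ^ lam)⁻¹ : ℝ)) *
          ((𝐞 (-((u : ℝ) * t / (k ^ (κ + lam) : ℕ))) : ℂ) *
            (𝐞 (-((v : ℝ) * (t / (k : ℝ) ^ lam - (h : ℝ) / (k : ℝ) ^ ρ))) : ℂ))) •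
          (coefC k κ ρ f D u h * F (v * k ^ κ)) := by
    refine sum_congr rfl fun h _ => ?_
    rw [phaseSumP, fourierPiece, ← Complex.coe_smul, smul_mul_smul', sum_mul_sum, smul_sum]
    refine sum_congr rfl fun u _ => ?_
    rw [smul_sum]
    refine sum_congr rfl fun v _ => ?_
    rw [smul_mul_smul', smul_smul]
  rw [hL, hR]
  simp only [smul_sum, smul_smul]
  calc ∑ v ∈ range (k ^ lam), ∑ u ∈ range (k ^ κ), ∑ h ∈ range (k ^ ρ),
        ((((k ^ (κ + lam) : ℕ) : ℂ)⁻¹) *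
          ((𝐞 (-(((u + v * k ^ κ : ℕ) : ℝ) * t / (k ^ (κ + lam) : ℕ))) : ℂ) *
            (𝐞 ((v : ℝ) * h / (k ^ ρ : ℕ)) : ℂ))) • (coefC k κ ρ f D u h * F (v * k ^ κ))
      = ∑ v ∈ range (k ^ lam), ∑ h ∈ range (k ^ ρ), ∑ u ∈ range (k ^ κ),
        ((((k ^ (κ + lam) : ℕ) : ℂ)⁻¹) *
          ((𝐞 (-(((u + v * k ^ κ : ℕ) : ℝ) * t / (k ^ (κ + lam) : ℕ))) : ℂ) *
            (𝐞 ((v : ℝ) * h / (k ^ ρ : ℕ)) : ℂ))) • (coefC k κ ρ f D u h * F (v * k ^ κ)) :=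
        sum_congr rfl fun v _ => sum_comm
    _ = ∑ h ∈ range (k ^ ρ), ∑ v ∈ range (k ^ lam), ∑ u ∈ range (k ^ κ),
        ((((k ^ (κ + lam) : ℕ) : ℂ)⁻¹) *
          ((𝐞 (-(((u + v * k ^ κ : ℕ) : ℝ) * t / (k ^ (κ + lam) : ℕ))) : ℂ) *
            (𝐞 ((v : ℝ) * h / (k ^ ρ : ℕ)) : ℂ))) • (coefC k κ ρ f D u h * F (v * k ^ κ)) :=
        sum_comm
    _ = ∑ h ∈ range (k ^ ρ), ∑ u ∈ range (k ^ κ), ∑ v ∈ range (k ^ lam),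
        ((((k ^ (κ + lam) : ℕ) : ℂ)⁻¹) *
          ((𝐞 (-(((u + v * k ^ κ : ℕ) : ℝ) * t / (k ^ (κ + lam) : ℕ))) : ℂ) *
            (𝐞 ((v : ℝ) * h / (k ^ ρ : ℕ)) : ℂ))) • (coefC k κ ρ f D u h * F (v * k ^ κ)) :=
        sum_congr rfl fun h _ => sum_comm
    _ = _ := by
        refine sum_congr rfl fun h _ => sum_congr rfl fun u _ => sum_congr rfl fun v _ => ?_
        rw [fourierChar_digitSplit (lam := lam) hk t u v h]
        congr 1
        push_cast
        ring

/-- **The main part is small by the Fourier property**: if `F ∈ F_{γ,c}` (Müllner Def. 4.2) and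
`κ ≤ cλ` then `‖dftR (k^{κ+λ}) mainPart t‖ ≤ k^{−γ(λ)} ∑_{h<k^ρ} ‖P_h(t)‖` (`k ≥ 1`).
[cite: MauduitRivat2015, display after (37) ("we may use (7) … we get")] -/
theorem norm_dftR_mainPart_le (hk : 0 < k) {γ : ℝ → ℝ} {c : ℝ}
    (hfour : HasFourierProperty k γ c F) (hκc : (κ : ℝ) ≤ c * lam) (t : ℝ) :
    ‖dftR (k ^ (κ + lam)) (mainPart k κ ρ f D F) t‖ ≤
      (k : ℝ) ^ (-γ lam) * ∑ h ∈ range (k ^ ρ), ‖phaseSumP k κ lam ρ f D t h‖ := by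
  rw [dftR_mainPart_eq hk, mul_sum]
  refine (norm_sum_le _ _).trans (sum_le_sum fun h _ => ?_)
  refine (norm_mul_le _ _).trans ?_
  rw [mul_comm]
  refine mul_le_mul_of_nonneg_right ?_ (norm_nonneg _)
  exact hfour κ lam hκc _

end Setting

end Literature.NumberTheory.LFunctions.MauduitRivat
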